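import Summits.QuantumFields.YangMills.Theorems.BalabanUVNodesN15SmallFieldAllLayersDirichletKnit
import Summits.QuantumFields.YangMills.Theorems.BalabanUVNodesN15SmallFieldKnitAdjoint
import Summits.QuantumFields.YangMills.Theorems.BalabanUVNodesN15SmallFieldAllLayersCovariantKnit
import HarnessLib

/-!
# N15 = NE2 — PROGRAMME ∂* «ADJOINT ENTRY», part (∂-2): ★★★ THE ALL-LIVE KNITS (TORUS AND DIRICHLET REGION) WITH ENTRY 2 OF (3.42) IN THE PRINTED ADJOINT ARRANGEMENT `𝒢∘∇^{U*}` —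
# `Live ∧ N15At` for dag-n15-c's live small-field family, OPERATOR = (∂-1) `ne2PlusOperator_sf₄adj` (n15-c∕180), SITE = (J-c) `foSiteSf`, UNIT = (L-4) `foCovSf` (torus) ∕ (Ð-4)
# `foCovSfLam` (Dirichlet covariance of `Λ = B(Λ′₀)`, `inΛ := inLamSf`); closed literals `sfObjects₄adjAll … wAdjAll`, `sfObjects₄adjLam … wAdjLam`; keyed faces
# (dag-n15-a g31, FILE (∂-2); node N15 = NE2; `--supports stmt-QuantumFields-27366 --as helper`, count-neutral; 4 plumbing defs + theorems; imports (Ð-5), (∂-1), (Q-5))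

WHY.  (L-5) `live_and_n15At_sf₄cov_allLive` and (Ð-5) `live_and_n15At_sf₄cov_allLiveLam` are this lane's literals with ALL THREE LAYERS reading the non-abelian potential `A′` (the
located burden of FLAG №13 typed for road (c), at MODEL level); their operator layer is Σ-F's `sfE₄cov`, whose slot 2 is a second covariant FORWARD gradient.  [B9] Thm 3.1 (3.42) prints
entry 2 as `G(U)∇*_U`; n15-c∕180 proved the operator layer in that ADJOINT arrangement and (∂-1) made it concrete (`sfE₄adj`, `ne2PlusOperator_sf₄adj`).  This file is (L-5) §2–§3 and
(Ð-5) §2–§3 with the operator layer re-pinned to (∂-1) — the SAME site and unit rows, the SAME guards, the SAME composition; nothing re-proved, nothing in the tree modified.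

WHAT.  §1 ★★★ `live_and_n15At_sf₄adj_allLive` (`∃ w, Live ∧ N15At` on `SfIdxGE d L w`: OPERATOR (∂-1) restricted, SITE (J-c) `ne2PlusSite_foSiteSf` restricted, UNIT (L-4)
`ne2PlusUnit_foCovSf`, GUARD (L-5) `live_sfGE`; `inΛ := ⊤` — the unit TEMPLATE's region read on the whole torus, as (L-5)); §1b literal `sfObjects₄adjAll … w : NE2Objects₁₁` (`rfl` to the
bundle), `exists_live_and_n15At_sfObjects₄adjAll`, pinned threshold `wAdjAll` (a `Classical.choose` — NON-EXPLICIT cube floor, FILE 133's `w₀` being existential; any re-pin keyed to it must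
say so), ★★★ `live_and_n15At_sfObjects₄adjAll_wAdjAll` (CLOSED literal), keyed face `s_N15_of_admits_sf₄adjAll`.  §2 ★★★ `live_and_n15At_sf₄adj_allLiveLam` (`∃ w, Live ∧ N15At` on
`SfIdxGE d L w × RegIdx0 d`: OPERATOR (∂-1), SITE (J-c), UNIT (Ð-4) `ne2PlusUnit_foCovSfLam` with the GENUINE region predicate `inLamSf` (sites of `Λ = B(Λ′₀)`, origin-anchored regions),
GUARD (Ð-5) `live_sfGELam`); §2b literal `sfObjects₄adjLam … w`, `exists_…`, pinned threshold `wAdjLam` (non-explicit, said), ★★★ `live_and_n15At_sfObjects₄adjLam_wAdjLam` (CLOSED literal: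
guard ∧ `N15At`, NO U-blind layer, NO `⊤` region, entry 2 AS PRINTED), keyed face `s_N15_of_admits_sf₄adjLam` (part 30's interface).  §3 ★★★ `live_and_n15At_sf₄adj_covQ_allLiveLam` — (Q-5)'s knit (covariantly perturbed site∕unit averaging for EVERY family with
the displayed rows `hfam`, Dirichlet region) with the operator layer re-pinned to (∂-1): the most print-faithful `Live ∧ N15At` of this lane (printed entry 2 + (3.81)-shaped averaging + §E region).

HONEST FRAMING ∕ LIMITS.  By-name composition over landed rows ((∂-1) ← n15-c∕180; (J-c); (L-4); (Ð-4); (L-5)∕(Ð-5) guards and restriction lemmas); NO estimate of this lane's.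
MODEL objects exactly as n15-c FILE 130∕133∕145∕179∕180 and (J-b′)(H)(L-1)…(L-4)(Ð-1)…(Ð-4): global small-field gauge `u ≡ 1`; covariant Laplacian (3.50) ⊗ colour + FLAT nonlocal part
(1.69) — NOT Bałaban's `Δ_a(U)` (3.26); `Reg336` idle ∕ no `D^{(2)}` term of (3.156); the site ∕ unit sandwich averages FLATLY (`Q ⊗ 1`, not the covariant `Q(U)`); King-block-mean
pairing; doubled-torus cover; `L ≥ 7`; large cubes above a NON-EXPLICIT floor (in print `M` is one fixed large integer — the sub-family is the template's `∀ i` restricted, said); crude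
constants (rate exponents `1∕(16(d+1))` operator ∕ `1∕16` site–unit) — ref-B READ-989 items (i)(iii)(iv)(v)(vi) UNTOUCHED, item (ii) addressed for the unit conjunct as in (Ð-5).  The η-RATE
inequalities are NOT PRINTED as such ([B9] Thm 3.14 = domain differences).  NOT [B9] Thms 3.1∕3.2∕3.15 AS PRINTED.  N15 stays DISCHARGED OF RECORD AS CONSUMED (U-blind v7 pin, p687738) —
no re-pin asked (road (b)∕(c) re-pins are the PLAN's; a re-pin keyed to THESE literals would fire FLAG №13 t2 by definition — the director's word, not mine), nothing re-claimed, no count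
moved (typed 28∕28 · discharged 8∕28); K3⁸ OPEN; one finite 𝕋⁴ at fixed ε per index — NOT ℝ⁴ ∕ infinite volume ∕ OS ∕ mass gap ∕ Clay.  Four plumbing `def`s ⇒ review ∕ audit lane.
No `sorry`, `instance`, `notation`, `maxHeartbeats`; standard axioms.
[cite: Balaban1985BackgroundPropagators, Thm 3.1 (3.42) p.397 (the four entries `G`, `∇_UG`, `G∇*_U`, `Δ_UG`), Thm 3.2 (3.48) p.398 + (3.132) p.422, Thm 3.15 (3.187) p.432 (quantifier templates), §E pp.427–428 (Dirichlet region);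
Balaban1984PropagatorsII, Lemma 2.4 p.245, (2.154)–(2.156) pp.249–250; King1986, Lemma 4.5 (4.38) p.674 (A = 0 template)]
-/

noncomputable section

open scoped BigOperators Matrix Matrix.Norms.Frobenius Kronecker

namespace Summit.QuantumFields.YangMills.BalabanUVNodes.N15.SiteLayerSf

open Literature.MathematicalPhysics.QuantumFieldTheory.Balaban1983to89
open Literature.MathematicalPhysics.QuantumFieldTheory.Balaban1983to89.T4EtaRate (PairedInstance NE2PlusOperator NE2PlusSite NE2PlusUnit)
open Literature.MathematicalPhysics.QuantumFieldTheory.Balaban1983to89.B5Prop11Plancherel (Tor)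
open Literature.Barriers.QuantumFields (traceForm)
open Summit.QuantumFields.YangMills.BalabanUVNodes.N15.Gluing (SfIdx sfInstance sfFamily CvX CvX' cvM cvBlk CvNorm)
open Literature.MathematicalPhysics.QuantumFieldTheory.Balaban1983to89.B6UnitTorusCarrier (unitTorusGeo)
open Summit.QuantumFields.YangMills.BalabanUVNodes.N15.GenuineRecord (sfE₄adj ne2PlusOperator_sf₄adj)
open Summit.QuantumFields.YangMills.BalabanUVNodes.N15.PairedFamilyGuard (Live)
open Literature.MathematicalPhysics.QuantumFieldTheory.Balaban1983to89.T4EtaRateCoeffDefect (pull)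
open Literature.MathematicalPhysics.QuantumFieldTheory.Balaban1983to89.B11SectG (BlockNorm HasMaj)
open Literature.MathematicalPhysics.QuantumFieldTheory.King1986.Torus (blockOf)
open Summit.QuantumFields.YangMills.BalabanUVNodes.N15.VectorPiece (kingPrV)
open Summit.QuantumFields.YangMills.BalabanUVNodes.N15.MatrixSpecies (liftMap)
open Literature.MathematicalPhysics.QuantumFieldTheory.Balaban1983to89.T4Continuum (T4Family ULoop)
open Node00 (NE2Objects₁₁)
open Summit.QuantumFields.YangMills.BalabanUVNodes.N15.AtKeyedHome (s_N15_of_admits)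
open YMDAG.UVSplit (Datum RateCarriers RateRecordPred N15At S_N15 ne2OfRecord₁₁)
open Literature.MathematicalPhysics.QuantumFieldTheory.Balaban1983to89.B6Lemma24Torus (pbox)
open Literature.MathematicalPhysics.QuantumFieldTheory.Balaban1983to89.B6Cov2156Torus (deltaPol one_le_M freeT)
open Literature.MathematicalPhysics.QuantumFieldTheory.Balaban1983to89.B6Cov2156TorusSubset (lamFree lamFree_subset subFamilyT)
open Literature.MathematicalPhysics.QuantumFieldTheory.Balaban1983to89.B6LowerBound2153Torus (rep rep_mem_pbox InLam)
open Literature.MathematicalPhysics.QuantumFieldTheory.Balaban1983to89.T4Cov2156Rate (isUnit_sandwich_subfamily)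
open Summit.QuantumFields.YangMills.BalabanUVNodes.N15.MatrixSpecies (liftBlk)
open Summit.QuantumFields.YangMills.BalabanUVNodes.N15.UnitLayerBg (exDress exDress_zero)
open Summit.QuantumFields.YangMills.BalabanUVNodes.N15.UnitLayerBgCol (covCS covCS_kron_one kron_one_apply isUnit_det_smul_one_add_deltaCol)
open Summit.QuantumFields.YangMills.BalabanUVNodes.N15.GluedZeroField (zLiveC zLiveF exists_zLive_zero)
open Summit.QuantumFields.YangMills.BalabanUVNodes.N15.GenuineRecord (sfTG covDiffLam covOnSLam covOnSLam_ker)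

variable (d : ℕ) {L : ℕ} [NeZero L] (mm ι : Type) [Fintype mm] [DecidableEq mm] [Fintype ι] [DecidableEq ι] (a : ℝ) (e : Matrix mm mm ℂ ≃L[ℝ] (ι → ℝ))

/-! ## §1 ★★★ The all-live knit on the torus with the printed entry 2 -/

section Knit

/-- ★★★ **`Live ∧ N15At` FOR dag-n15-c's LIVE SMALL-FIELD FAMILY WITH ALL THREE LAYERS READING `A′`, ENTRY 2 AS PRINTED** (large-cube sub-family `SfIdxGE d L w`): `d ≥ 1`, odd `L ≥ 7`, `a, c₃₅ > 0`,
trace-form-orthonormal `e`, `ι` nonempty; directions `μ₁ μ₂` (operator entries 1–2), `α β` + colours `j j′` (site bonds), `α′ β′` + colours `j₂ j₂′` (unit bonds), any `p`: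
OPERATOR = (∂-1) `ne2PlusOperator_sf₄adj` (restricted; entry 2 in the PRINTED adjoint arrangement `𝒢∘∇^{U*}`, n15-c∕180), SITE = (J-c) `ne2PlusSite_foSiteSf` (restricted), UNIT = (L-4) `ne2PlusUnit_foCovSf`, GUARD = `live_sfGE`. [bookkeeping] -/
theorem live_and_n15At_sf₄adj_allLive [Nonempty ι] (hd : 1 ≤ d) (hL : Odd L ∧ 1 < L) (hL7 : 7 ≤ L) (ha : 0 < a) {c35 : ℝ} (hc35 : 0 < c35)
    (he : ∀ A B : Matrix mm mm ℂ, traceForm A B = e A ⬝ᵥ e B) (μ₁ μ₂ α β : Fin (d + 1)) (j j' : ι) (α' β' : Fin (d + 1)) (j₂ j₂' : ι) (p : ℝ) :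
    ∃ w : ℝ,
      Live ⟨SfIdxGE d L w, c35, p, fun i => sfInstance d mm ι hL i.1, fun i => sfFamily d mm ι a e hL i.1 (sfE₄adj d mm ι a e hL μ₁ μ₂ i.1), fun i => foSiteSf d mm ι a e hL α β j j' i.1,
          fun i => foCovSf d mm ι a e hL α' β' j₂ j₂' i.1, fun _ _ => True, fun i => (sfInstance d mm ι hL i.1).gc.dist⟩ ∧
      N15At { I := SfIdxGE d L w, c35 := c35, p := p, pi := fun i => sfInstance d mm ι hL i.1, Kop := fun i => sfFamily d mm ι a e hL i.1 (sfE₄adj d mm ι a e hL μ₁ μ₂ i.1),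
              Ksite := fun i => foSiteSf d mm ι a e hL α β j j' i.1, Kunit := fun i => foCovSf d mm ι a e hL α' β' j₂ j₂' i.1,
              inΛ := fun _ _ => True, unitDist := fun i => (sfInstance d mm ι hL i.1).gc.dist } := by
  obtain ⟨w, hunit⟩ := ne2PlusUnit_foCovSf d mm ι a e hd hL hL7 ha hc35 he α' β' j₂ j₂'
  exact ⟨w, live_sfGE d mm ι hL w hc35.le p _ _ _,
    ⟨ne2PlusOperator_comp (fun i : SfIdxGE d L w => i.1) (ne2PlusOperator_sf₄adj d mm ι e hL hL7 ha hc35 he μ₁ μ₂),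
      ne2PlusSite_comp (fun i : SfIdxGE d L w => i.1) (ne2PlusSite_foSiteSf d mm ι a e hL hL7 ha hc35 he α β j j' 4 p), hunit⟩⟩

/-! ## §1b The road-(c) literal with ALL layers U-live and the printed entry 2 (pinned threshold); keyed face -/

/-- **THE ROAD-(c) LITERAL WITH ALL THREE LAYERS U-LIVE** at a size threshold `w`: `NE2Objects₁₁` with n15-c's family restricted to `SfIdxGE d L w`, (∂-1)'s adjoint-entry operator layer, (J-c)'s site
kernel, (L-4)'s unit kernel. [bookkeeping] -/
def sfObjects₄adjAll (hL : Odd L ∧ 1 < L) (μ₁ μ₂ α β : Fin (d + 1)) (j j' : ι) (α' β' : Fin (d + 1)) (j₂ j₂' : ι) (c35 p w : ℝ) : NE2Objects₁₁ :=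
  ⟨SfIdxGE d L w, c35, p, fun i => sfInstance d mm ι hL i.1, fun i => sfFamily d mm ι a e hL i.1 (sfE₄adj d mm ι a e hL μ₁ μ₂ i.1), fun i => foSiteSf d mm ι a e hL α β j j' i.1,
    fun i => foCovSf d mm ι a e hL α' β' j₂ j₂' i.1, fun _ _ => True, fun i => (sfInstance d mm ι hL i.1).gc.dist⟩

/-- the record map reads the literal as the rates bundle (`rfl`). [bookkeeping] -/
theorem ne2OfRecord₁₁_sfObjects₄adjAll (hL : Odd L ∧ 1 < L) (μ₁ μ₂ α β : Fin (d + 1)) (j j' : ι) (α' β' : Fin (d + 1)) (j₂ j₂' : ι) (c35 p w : ℝ) :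
    ne2OfRecord₁₁ (sfObjects₄adjAll d mm ι a e hL μ₁ μ₂ α β j j' α' β' j₂ j₂' c35 p w) =
      { I := SfIdxGE d L w, c35 := c35, p := p, pi := fun i => sfInstance d mm ι hL i.1, Kop := fun i => sfFamily d mm ι a e hL i.1 (sfE₄adj d mm ι a e hL μ₁ μ₂ i.1),
        Ksite := fun i => foSiteSf d mm ι a e hL α β j j' i.1, Kunit := fun i => foCovSf d mm ι a e hL α' β' j₂ j₂' i.1,
        inΛ := fun _ _ => True, unitDist := fun i => (sfInstance d mm ι hL i.1).gc.dist } := rfl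

/-- ★★ there IS a threshold at which the all-live literal passes the guard and `N15At` (restatement of `live_and_n15At_sf₄adj_allLive` through the literal). [bookkeeping] -/
theorem exists_live_and_n15At_sfObjects₄adjAll [Nonempty ι] (hd : 1 ≤ d) (hL : Odd L ∧ 1 < L) (hL7 : 7 ≤ L) (ha : 0 < a) {c35 : ℝ} (hc35 : 0 < c35)
    (he : ∀ A B : Matrix mm mm ℂ, traceForm A B = e A ⬝ᵥ e B) (μ₁ μ₂ α β : Fin (d + 1)) (j j' : ι) (α' β' : Fin (d + 1)) (j₂ j₂' : ι) (p : ℝ) :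
    ∃ w : ℝ, Live (ne2OfRecord₁₁ (sfObjects₄adjAll d mm ι a e hL μ₁ μ₂ α β j j' α' β' j₂ j₂' c35 p w)) ∧
      N15At (ne2OfRecord₁₁ (sfObjects₄adjAll d mm ι a e hL μ₁ μ₂ α β j j' α' β' j₂ j₂' c35 p w)) :=
  live_and_n15At_sf₄adj_allLive d mm ι a e hd hL hL7 ha hc35 he μ₁ μ₂ α β j j' α' β' j₂ j₂' p

/-- **THE PINNED THRESHOLD** `w_all` (a choice of the threshold of `exists_live_and_n15At_sfObjects₄adjAll`; depends on `(d, L, mm, ι, a, e, c₃₅, directions, colours, p)` through the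
hypotheses it is chosen under). [bookkeeping] -/
def wAdjAll [Nonempty ι] (hd : 1 ≤ d) (hL : Odd L ∧ 1 < L) (hL7 : 7 ≤ L) (ha : 0 < a) {c35 : ℝ} (hc35 : 0 < c35) (he : ∀ A B : Matrix mm mm ℂ, traceForm A B = e A ⬝ᵥ e B)
    (μ₁ μ₂ α β : Fin (d + 1)) (j j' : ι) (α' β' : Fin (d + 1)) (j₂ j₂' : ι) (p : ℝ) : ℝ :=
  Classical.choose (exists_live_and_n15At_sfObjects₄adjAll d mm ι a e hd hL hL7 ha hc35 he μ₁ μ₂ α β j j' α' β' j₂ j₂' p)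

/-- ★★★ **GUARD ∧ `N15At` AT THE ALL-LIVE LITERAL PINNED AT `w_all`** (`d ≥ 1`, odd `L ≥ 7`, `a, c₃₅ > 0`, trace-form-orthonormal `e`, `ι` nonempty) — a CLOSED literal for a road-(c)
re-pin with NO U-blind layer. [bookkeeping] -/
theorem live_and_n15At_sfObjects₄adjAll_wAdjAll [Nonempty ι] (hd : 1 ≤ d) (hL : Odd L ∧ 1 < L) (hL7 : 7 ≤ L) (ha : 0 < a) {c35 : ℝ} (hc35 : 0 < c35)
    (he : ∀ A B : Matrix mm mm ℂ, traceForm A B = e A ⬝ᵥ e B) (μ₁ μ₂ α β : Fin (d + 1)) (j j' : ι) (α' β' : Fin (d + 1)) (j₂ j₂' : ι) (p : ℝ) :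
    Live (ne2OfRecord₁₁ (sfObjects₄adjAll d mm ι a e hL μ₁ μ₂ α β j j' α' β' j₂ j₂' c35 p (wAdjAll d mm ι a e hd hL hL7 ha hc35 he μ₁ μ₂ α β j j' α' β' j₂ j₂' p))) ∧
      N15At (ne2OfRecord₁₁ (sfObjects₄adjAll d mm ι a e hL μ₁ μ₂ α β j j' α' β' j₂ j₂' c35 p (wAdjAll d mm ι a e hd hL hL7 ha hc35 he μ₁ μ₂ α β j j' α' β' j₂ j₂' p))) :=
  Classical.choose_spec (exists_live_and_n15At_sfObjects₄adjAll d mm ι a e hd hL hL7 ha hc35 he μ₁ μ₂ α β j j' α' β' j₂ j₂' p)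

variable {N : ℕ} [NeZero N] {key : (F : T4Family) → Datum F N → Prop}

/-- ★★ **THE ALL-LIVE LITERAL AT ANY KEYED HOME** (part 30's interface): a rate home over ANY key admitting only the literals of a key-indexed NE2 reading whose value everywhere is the
pinned all-live literal has `S_N15 RRec` (`d ≥ 1`, odd `L ≥ 7`, `a, c₃₅ > 0`, trace-form-orthonormal `e`, `ι` nonempty). [bookkeeping] -/
theorem s_N15_of_admits_sf₄adjAll [Nonempty ι] (hd : 1 ≤ d) (hL : Odd L ∧ 1 < L) (hL7 : 7 ≤ L) (ha : 0 < a) {c35 : ℝ} (hc35 : 0 < c35)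
    (he : ∀ A B : Matrix mm mm ℂ, traceForm A B = e A ⬝ᵥ e B) (μ₁ μ₂ α β : Fin (d + 1)) (j j' : ι) (α' β' : Fin (d + 1)) (j₂ j₂' : ι) (p : ℝ)
    (ne2At : ∀ {F : T4Family} {D : Datum F N}, key F D → (ℕ → ℝ) → List (ULoop F) → ℕ → NE2Objects₁₁) (RRec : RateRecordPred N)
    (hadm : ∀ (F : T4Family) (D : Datum F N) (g₀ : ℕ → ℝ) (os : List (ULoop F)) (R : RateCarriers N), RRec F D g₀ os R →
      ∃ (h : key F D) (k : ℕ), R.ne2 = ne2OfRecord₁₁ (ne2At h g₀ os k))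
    (h : ∀ (F : T4Family) (D : Datum F N) (h : key F D) (g₀ : ℕ → ℝ) (os : List (ULoop F)) (k : ℕ),
      ne2At h g₀ os k = sfObjects₄adjAll d mm ι a e hL μ₁ μ₂ α β j j' α' β' j₂ j₂' c35 p (wAdjAll d mm ι a e hd hL hL7 ha hc35 he μ₁ μ₂ α β j j' α' β' j₂ j₂' p)) :
    S_N15 RRec :=
  s_N15_of_admits ne2At RRec hadm fun F D hk g₀ os k => by
    rw [h F D hk g₀ os k]; exact (live_and_n15At_sfObjects₄adjAll_wAdjAll d mm ι a e hd hL hL7 ha hc35 he μ₁ μ₂ α β j j' α' β' j₂ j₂' p).2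

/-! ## §2 ★★★ The all-live knit with the Dirichlet region and the printed entry 2 -/


/-- ★★★ **`Live ∧ N15At` FOR dag-n15-c's LIVE SMALL-FIELD FAMILY WITH ALL THREE LAYERS READING `A′` AND A GENUINE DIRICHLET REGION IN THE UNIT LAYER, ENTRY 2 AS PRINTED** (sub-family `SfIdxGE d L w × RegIdx0 d`):
`d ≥ 1`, odd `L ≥ 7`, `a, c₃₅ > 0`, trace-form-orthonormal `e`, `ι` nonempty; directions `μ₁ μ₂` (operator entries 1–2), `α β` + colours `j j′` (site bonds), `α′ β′` + colours `j₂ j₂′` (unit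
bonds), any `p`: OPERATOR = (∂-1) `ne2PlusOperator_sf₄adj` (entry 2 in the PRINTED adjoint arrangement, n15-c∕180), SITE = (J-c) `ne2PlusSite_foSiteSf`, UNIT = (Ð-4) `ne2PlusUnit_foCovSfLam` (Dirichlet covariance of `Λ = B(Λ′₀)`, read on Λ:
`inΛ := inLamSf`), GUARD = `live_sfGELam`. [bookkeeping] -/
theorem live_and_n15At_sf₄adj_allLiveLam [Nonempty ι] (hd : 1 ≤ d) (hL : Odd L ∧ 1 < L) (hL7 : 7 ≤ L) (ha : 0 < a) {c35 : ℝ} (hc35 : 0 < c35)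
    (he : ∀ A B : Matrix mm mm ℂ, traceForm A B = e A ⬝ᵥ e B) (μ₁ μ₂ α β : Fin (d + 1)) (j j' : ι) (α' β' : Fin (d + 1)) (j₂ j₂' : ι) (p : ℝ) :
    ∃ w : ℝ,
      Live ⟨SfIdxGE d L w × RegIdx0 d, c35, p, fun x => sfInstance d mm ι hL x.1.1, fun x => sfFamily d mm ι a e hL x.1.1 (sfE₄adj d mm ι a e hL μ₁ μ₂ x.1.1),
          fun x => foSiteSf d mm ι a e hL α β j j' x.1.1, fun x => foCovSfLam d mm ι a e hL α' β' j₂ j₂' x.1.1 x.2.1, fun x => inLamSf d mm ι hL x.1.1 x.2.1,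
          fun x => (sfInstance d mm ι hL x.1.1).gc.dist⟩ ∧
      N15At { I := SfIdxGE d L w × RegIdx0 d, c35 := c35, p := p, pi := fun x => sfInstance d mm ι hL x.1.1,
              Kop := fun x => sfFamily d mm ι a e hL x.1.1 (sfE₄adj d mm ι a e hL μ₁ μ₂ x.1.1),
              Ksite := fun x => foSiteSf d mm ι a e hL α β j j' x.1.1, Kunit := fun x => foCovSfLam d mm ι a e hL α' β' j₂ j₂' x.1.1 x.2.1,
              inΛ := fun x => inLamSf d mm ι hL x.1.1 x.2.1, unitDist := fun x => (sfInstance d mm ι hL x.1.1).gc.dist } := by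
  obtain ⟨w, hunit⟩ := ne2PlusUnit_foCovSfLam d mm ι a e hd hL hL7 ha hc35 he α' β' j₂ j₂'
  exact ⟨w, live_sfGELam d mm ι hL w hc35.le p _ _ _,
    ⟨ne2PlusOperator_comp (fun x : SfIdxGE d L w × RegIdx0 d => x.1.1) (ne2PlusOperator_sf₄adj d mm ι e hL hL7 ha hc35 he μ₁ μ₂),
      ne2PlusSite_comp (fun x : SfIdxGE d L w × RegIdx0 d => x.1.1) (ne2PlusSite_foSiteSf d mm ι a e hL hL7 ha hc35 he α β j j' 4 p),
      ne2PlusUnit_comp (fun x : SfIdxGE d L w × RegIdx0 d => ((x.1, x.2.1) : SfIdxGE d L w × Finset (Fin (d + 1) → ℤ))) hunit⟩⟩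

/-! ## §2b The road-(c) literal with ALL layers U-live, the Dirichlet region and the printed entry 2 (pinned threshold); keyed face -/

/-- **THE ROAD-(c) LITERAL WITH ALL THREE LAYERS U-LIVE AND A GENUINE DIRICHLET REGION** at a size threshold `w`: `NE2Objects₁₁` with n15-c's family on `SfIdxGE d L w × RegIdx0 d`, (∂-1)'s
adjoint-entry operator layer, (J-c)'s site kernel, (Ð-4)'s Dirichlet unit kernel and region predicate. [bookkeeping] -/
def sfObjects₄adjLam (hL : Odd L ∧ 1 < L) (μ₁ μ₂ α β : Fin (d + 1)) (j j' : ι) (α' β' : Fin (d + 1)) (j₂ j₂' : ι) (c35 p w : ℝ) : NE2Objects₁₁ :=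
  ⟨SfIdxGE d L w × RegIdx0 d, c35, p, fun x => sfInstance d mm ι hL x.1.1, fun x => sfFamily d mm ι a e hL x.1.1 (sfE₄adj d mm ι a e hL μ₁ μ₂ x.1.1),
    fun x => foSiteSf d mm ι a e hL α β j j' x.1.1, fun x => foCovSfLam d mm ι a e hL α' β' j₂ j₂' x.1.1 x.2.1, fun x => inLamSf d mm ι hL x.1.1 x.2.1,
    fun x => (sfInstance d mm ι hL x.1.1).gc.dist⟩

/-- the record map reads the literal as the rates bundle (`rfl`). [bookkeeping] -/
theorem ne2OfRecord₁₁_sfObjects₄adjLam (hL : Odd L ∧ 1 < L) (μ₁ μ₂ α β : Fin (d + 1)) (j j' : ι) (α' β' : Fin (d + 1)) (j₂ j₂' : ι) (c35 p w : ℝ) :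
    ne2OfRecord₁₁ (sfObjects₄adjLam d mm ι a e hL μ₁ μ₂ α β j j' α' β' j₂ j₂' c35 p w) =
      { I := SfIdxGE d L w × RegIdx0 d, c35 := c35, p := p, pi := fun x => sfInstance d mm ι hL x.1.1,
        Kop := fun x => sfFamily d mm ι a e hL x.1.1 (sfE₄adj d mm ι a e hL μ₁ μ₂ x.1.1),
        Ksite := fun x => foSiteSf d mm ι a e hL α β j j' x.1.1, Kunit := fun x => foCovSfLam d mm ι a e hL α' β' j₂ j₂' x.1.1 x.2.1,
        inΛ := fun x => inLamSf d mm ι hL x.1.1 x.2.1, unitDist := fun x => (sfInstance d mm ι hL x.1.1).gc.dist } := rfl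

/-- ★★ there IS a threshold at which the Dirichlet all-live literal passes the guard and `N15At` (restatement of `live_and_n15At_sf₄adj_allLiveLam` through the literal). [bookkeeping] -/
theorem exists_live_and_n15At_sfObjects₄adjLam [Nonempty ι] (hd : 1 ≤ d) (hL : Odd L ∧ 1 < L) (hL7 : 7 ≤ L) (ha : 0 < a) {c35 : ℝ} (hc35 : 0 < c35)
    (he : ∀ A B : Matrix mm mm ℂ, traceForm A B = e A ⬝ᵥ e B) (μ₁ μ₂ α β : Fin (d + 1)) (j j' : ι) (α' β' : Fin (d + 1)) (j₂ j₂' : ι) (p : ℝ) :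
    ∃ w : ℝ, Live (ne2OfRecord₁₁ (sfObjects₄adjLam d mm ι a e hL μ₁ μ₂ α β j j' α' β' j₂ j₂' c35 p w)) ∧
      N15At (ne2OfRecord₁₁ (sfObjects₄adjLam d mm ι a e hL μ₁ μ₂ α β j j' α' β' j₂ j₂' c35 p w)) :=
  live_and_n15At_sf₄adj_allLiveLam d mm ι a e hd hL hL7 ha hc35 he μ₁ μ₂ α β j j' α' β' j₂ j₂' p

/-- **THE PINNED THRESHOLD** `w_Λ` (a `Classical.choose` of the threshold of `exists_live_and_n15At_sfObjects₄adjLam` — a NON-EXPLICIT cube floor, FILE 133's `w₀` being existential; depends on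
`(d, L, mm, ι, a, e, c₃₅, directions, colours, p)` through the hypotheses it is chosen under). [bookkeeping] -/
def wAdjLam [Nonempty ι] (hd : 1 ≤ d) (hL : Odd L ∧ 1 < L) (hL7 : 7 ≤ L) (ha : 0 < a) {c35 : ℝ} (hc35 : 0 < c35) (he : ∀ A B : Matrix mm mm ℂ, traceForm A B = e A ⬝ᵥ e B)
    (μ₁ μ₂ α β : Fin (d + 1)) (j j' : ι) (α' β' : Fin (d + 1)) (j₂ j₂' : ι) (p : ℝ) : ℝ :=
  Classical.choose (exists_live_and_n15At_sfObjects₄adjLam d mm ι a e hd hL hL7 ha hc35 he μ₁ μ₂ α β j j' α' β' j₂ j₂' p)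

/-- ★★★ **GUARD ∧ `N15At` AT THE DIRICHLET ALL-LIVE LITERAL PINNED AT `w_Λ`** (`d ≥ 1`, odd `L ≥ 7`, `a, c₃₅ > 0`, trace-form-orthonormal `e`, `ι` nonempty) — a CLOSED literal with NO
U-blind layer and NO `⊤` region. [bookkeeping] -/
theorem live_and_n15At_sfObjects₄adjLam_wAdjLam [Nonempty ι] (hd : 1 ≤ d) (hL : Odd L ∧ 1 < L) (hL7 : 7 ≤ L) (ha : 0 < a) {c35 : ℝ} (hc35 : 0 < c35)
    (he : ∀ A B : Matrix mm mm ℂ, traceForm A B = e A ⬝ᵥ e B) (μ₁ μ₂ α β : Fin (d + 1)) (j j' : ι) (α' β' : Fin (d + 1)) (j₂ j₂' : ι) (p : ℝ) :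
    Live (ne2OfRecord₁₁ (sfObjects₄adjLam d mm ι a e hL μ₁ μ₂ α β j j' α' β' j₂ j₂' c35 p (wAdjLam d mm ι a e hd hL hL7 ha hc35 he μ₁ μ₂ α β j j' α' β' j₂ j₂' p))) ∧
      N15At (ne2OfRecord₁₁ (sfObjects₄adjLam d mm ι a e hL μ₁ μ₂ α β j j' α' β' j₂ j₂' c35 p (wAdjLam d mm ι a e hd hL hL7 ha hc35 he μ₁ μ₂ α β j j' α' β' j₂ j₂' p))) :=
  Classical.choose_spec (exists_live_and_n15At_sfObjects₄adjLam d mm ι a e hd hL hL7 ha hc35 he μ₁ μ₂ α β j j' α' β' j₂ j₂' p)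


/-- ★★ **THE DIRICHLET ALL-LIVE LITERAL AT ANY KEYED HOME** (part 30's interface): a rate home over ANY key admitting only the literals of a key-indexed NE2 reading whose value everywhere
is the pinned Dirichlet all-live literal has `S_N15 RRec` (`d ≥ 1`, odd `L ≥ 7`, `a, c₃₅ > 0`, trace-form-orthonormal `e`, `ι` nonempty). [bookkeeping] -/
theorem s_N15_of_admits_sf₄adjLam [Nonempty ι] (hd : 1 ≤ d) (hL : Odd L ∧ 1 < L) (hL7 : 7 ≤ L) (ha : 0 < a) {c35 : ℝ} (hc35 : 0 < c35)
    (he : ∀ A B : Matrix mm mm ℂ, traceForm A B = e A ⬝ᵥ e B) (μ₁ μ₂ α β : Fin (d + 1)) (j j' : ι) (α' β' : Fin (d + 1)) (j₂ j₂' : ι) (p : ℝ)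
    (ne2At : ∀ {F : T4Family} {D : Datum F N}, key F D → (ℕ → ℝ) → List (ULoop F) → ℕ → NE2Objects₁₁) (RRec : RateRecordPred N)
    (hadm : ∀ (F : T4Family) (D : Datum F N) (g₀ : ℕ → ℝ) (os : List (ULoop F)) (R : RateCarriers N), RRec F D g₀ os R →
      ∃ (h : key F D) (k : ℕ), R.ne2 = ne2OfRecord₁₁ (ne2At h g₀ os k))
    (h : ∀ (F : T4Family) (D : Datum F N) (h : key F D) (g₀ : ℕ → ℝ) (os : List (ULoop F)) (k : ℕ),
      ne2At h g₀ os k = sfObjects₄adjLam d mm ι a e hL μ₁ μ₂ α β j j' α' β' j₂ j₂' c35 p (wAdjLam d mm ι a e hd hL hL7 ha hc35 he μ₁ μ₂ α β j j' α' β' j₂ j₂' p)) :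
    S_N15 RRec :=
  s_N15_of_admits ne2At RRec hadm fun F D hk g₀ os k => by
    rw [h F D hk g₀ os k]; exact (live_and_n15At_sfObjects₄adjLam_wAdjLam d mm ι a e hd hL hL7 ha hc35 he μ₁ μ₂ α β j j' α' β' j₂ j₂' p).2


/-! ## §3 ★★★ The most print-faithful literal of this lane: printed entry 2 + covariantly perturbed site∕unit averaging + Dirichlet region -/

/-- ★★★ **`Live ∧ N15At` WITH THE PRINTED ENTRY 2 AND A COVARIANTLY PERTURBED SITE∕UNIT AVERAGING, GENUINE DIRICHLET REGION** — (Q-5) `live_and_n15At_sf₄cov_covQ_allLiveLam` with the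
operator layer re-pinned to (∂-1) `ne2PlusOperator_sf₄adj`: OPERATOR (∂-1) (entry 2 `𝒢∘∇^{U*}`), SITE (Q-3) `ne2PlusSite_foSiteCov`, UNIT (Q-4) `ne2PlusUnit_foCovCovLam` (`inΛ := inLamSf`), for
EVERY averaging-perturbation family with the displayed rows `hfam`; GUARD (Ð-5) `live_sfGELam`. [bookkeeping] -/
theorem live_and_n15At_sf₄adj_covQ_allLiveLam [Nonempty ι] (hd : 1 ≤ d) (hL : Odd L ∧ 1 < L) (hL7 : 7 ≤ L) (ha : 0 < a) {c35 : ℝ} (hc35 : 0 < c35)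
    (he : ∀ A B : Matrix mm mm ℂ, traceForm A B = e A ⬝ᵥ e B) (μ₁ μ₂ α β : Fin (d + 1)) (j j' : ι) (α' β' : Fin (d + 1)) (j₂ j₂' : ι) (p : ℝ)
    (Dc : ∀ i : SfIdx d L, (Fin (d + 1) → CvX' d L i.m i.kk i.r hL → Matrix mm mm ℂ) → ((CvX d L i.m i.kk hL × ι → ℝ) →ₗ[ℝ] ((Tor (cvM d L i.m i.kk hL) × Fin (d + 1)) × ι → ℝ)))
    (Ec : ∀ i : SfIdx d L, (Fin (d + 1) → CvX' d L i.m i.kk i.r hL → Matrix mm mm ℂ) → (((Tor (cvM d L i.m i.kk hL) × Fin (d + 1)) × ι → ℝ) →ₗ[ℝ] (CvX d L i.m i.kk hL × ι → ℝ)))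
    (Df : ∀ i : SfIdx d L, (Fin (d + 1) → CvX' d L i.m i.kk i.r hL → Matrix mm mm ℂ) → ((CvX' d L i.m i.kk i.r hL × ι → ℝ) →ₗ[ℝ] ((Tor (cvM d L i.m i.kk hL) × Fin (d + 1)) × ι → ℝ)))
    (Ef : ∀ i : SfIdx d L, (Fin (d + 1) → CvX' d L i.m i.kk i.r hL → Matrix mm mm ℂ) → (((Tor (cvM d L i.m i.kk hL) × Fin (d + 1)) × ι → ℝ) →ₗ[ℝ] (CvX' d L i.m i.kk i.r hL × ι → ℝ)))
    (hfam : ∀ ρ : ℝ, 0 < ρ → ∃ KD s₀ : ℝ, 0 ≤ KD ∧ 0 < s₀ ∧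
      ∀ (i : SfIdx d L) (α₀ : ℝ) (A' : Fin (d + 1) → CvX' d L i.m i.kk i.r hL → Matrix mm mm ℂ), 0 < α₀ → c35 * (L : ℝ) ^ i.m * α₀ ≤ s₀ → (sfInstance d mm ι hL i).Bf.Reg335 c35 α₀ A' →
        HasMaj (CvNorm d L i.m i.kk hL ι) (BlockNorm.ofBlocks (unitTorusGeo L i.kk (cvM d L i.m i.kk hL)) (liftBlk (fun b : Tor (cvM d L i.m i.kk hL) × Fin (d + 1) => b.1) ι)) (Dc i A')
          (fun y y' => KD * (c35 * (L : ℝ) ^ i.m * α₀) * Real.exp (-(ρ * (unitTorusGeo L i.kk (cvM d L i.m i.kk hL)).dist y y'))) ∧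
        HasMaj (BlockNorm.ofBlocks (unitTorusGeo L i.kk (cvM d L i.m i.kk hL)) (liftBlk (fun b : CvX' d L i.m i.kk i.r hL => blockOf (L ^ i.r * L ^ i.kk) (cvM d L i.m i.kk hL) b.1) ι))
          (BlockNorm.ofBlocks (unitTorusGeo L i.kk (cvM d L i.m i.kk hL)) (liftBlk (fun b : Tor (cvM d L i.m i.kk hL) × Fin (d + 1) => b.1) ι)) (Df i A')
          (fun y y' => KD * (c35 * (L : ℝ) ^ i.m * α₀) * Real.exp (-(ρ * (unitTorusGeo L i.kk (cvM d L i.m i.kk hL)).dist y y'))) ∧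
        HasMaj (BlockNorm.ofBlocks (unitTorusGeo L i.kk (cvM d L i.m i.kk hL)) (liftBlk (fun b : Tor (cvM d L i.m i.kk hL) × Fin (d + 1) => b.1) ι)) (CvNorm d L i.m i.kk hL ι) (Ec i A')
          (fun y y' => KD * (c35 * (L : ℝ) ^ i.m * α₀) * Real.exp (-(ρ * (unitTorusGeo L i.kk (cvM d L i.m i.kk hL)).dist y y'))) ∧
        HasMaj (BlockNorm.ofBlocks (unitTorusGeo L i.kk (cvM d L i.m i.kk hL)) (liftBlk (fun b : Tor (cvM d L i.m i.kk hL) × Fin (d + 1) => b.1) ι))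
          (BlockNorm.ofBlocks (unitTorusGeo L i.kk (cvM d L i.m i.kk hL)) (liftBlk (fun b : CvX' d L i.m i.kk i.r hL => blockOf (L ^ i.r * L ^ i.kk) (cvM d L i.m i.kk hL) b.1) ι)) (Ef i A')
          (fun y y' => KD * (c35 * (L : ℝ) ^ i.m * α₀) * Real.exp (-(ρ * (unitTorusGeo L i.kk (cvM d L i.m i.kk hL)).dist y y'))) ∧
        HasMaj (CvNorm d L i.m i.kk hL ι) (BlockNorm.ofBlocks (unitTorusGeo L i.kk (cvM d L i.m i.kk hL)) (liftBlk (fun b : Tor (cvM d L i.m i.kk hL) × Fin (d + 1) => b.1) ι))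
          (Df i A' ∘ₗ pull (liftMap (kingPrV L i.kk i.r (cvM d L i.m i.kk hL)) ι) - Dc i A')
          (fun y y' => KD * ((((L ^ i.kk : ℕ) : ℝ)) ^ (-(1 / 16 : ℝ))) * Real.exp (-(ρ * (unitTorusGeo L i.kk (cvM d L i.m i.kk hL)).dist y y'))) ∧
        HasMaj (BlockNorm.ofBlocks (unitTorusGeo L i.kk (cvM d L i.m i.kk hL)) (liftBlk (fun b : Tor (cvM d L i.m i.kk hL) × Fin (d + 1) => b.1) ι))
          (BlockNorm.ofBlocks (unitTorusGeo L i.kk (cvM d L i.m i.kk hL)) (liftBlk (fun b : CvX' d L i.m i.kk i.r hL => blockOf (L ^ i.r * L ^ i.kk) (cvM d L i.m i.kk hL) b.1) ι))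
          (Ef i A' - pull (liftMap (kingPrV L i.kk i.r (cvM d L i.m i.kk hL)) ι) ∘ₗ Ec i A')
          (fun y y' => KD * ((((L ^ i.kk : ℕ) : ℝ)) ^ (-(1 / 16 : ℝ))) * Real.exp (-(ρ * (unitTorusGeo L i.kk (cvM d L i.m i.kk hL)).dist y y')))) :
    ∃ w : ℝ,
      Live ⟨SfIdxGE d L w × RegIdx0 d, c35, p, fun x => sfInstance d mm ι hL x.1.1, fun x => sfFamily d mm ι a e hL x.1.1 (sfE₄adj d mm ι a e hL μ₁ μ₂ x.1.1),
          fun x => foSiteCov d mm ι a e hL α β j j' Dc Ec Df Ef x.1.1, fun x => foCovCovLam d mm ι a e hL α' β' j₂ j₂' Dc Ec Df Ef x.1.1 x.2.1, fun x => inLamSf d mm ι hL x.1.1 x.2.1,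
          fun x => (sfInstance d mm ι hL x.1.1).gc.dist⟩ ∧
      N15At { I := SfIdxGE d L w × RegIdx0 d, c35 := c35, p := p, pi := fun x => sfInstance d mm ι hL x.1.1,
              Kop := fun x => sfFamily d mm ι a e hL x.1.1 (sfE₄adj d mm ι a e hL μ₁ μ₂ x.1.1),
              Ksite := fun x => foSiteCov d mm ι a e hL α β j j' Dc Ec Df Ef x.1.1, Kunit := fun x => foCovCovLam d mm ι a e hL α' β' j₂ j₂' Dc Ec Df Ef x.1.1 x.2.1,
              inΛ := fun x => inLamSf d mm ι hL x.1.1 x.2.1, unitDist := fun x => (sfInstance d mm ι hL x.1.1).gc.dist } := by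
  obtain ⟨w, hunit⟩ := ne2PlusUnit_foCovCovLam d mm ι a e hd hL hL7 ha hc35 he α' β' j₂ j₂' Dc Ec Df Ef hfam
  exact ⟨w, live_sfGELam d mm ι hL w hc35.le p _ _ _,
    ⟨ne2PlusOperator_comp (fun x : SfIdxGE d L w × RegIdx0 d => x.1.1) (ne2PlusOperator_sf₄adj d mm ι e hL hL7 ha hc35 he μ₁ μ₂),
      ne2PlusSite_comp (fun x : SfIdxGE d L w × RegIdx0 d => x.1.1) (ne2PlusSite_foSiteCov d mm ι a e hL hL7 ha hc35 he α β j j' 4 p Dc Ec Df Ef hfam),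
      ne2PlusUnit_comp (fun x : SfIdxGE d L w × RegIdx0 d => ((x.1, x.2.1) : SfIdxGE d L w × Finset (Fin (d + 1) → ℤ))) hunit⟩⟩

end Knit

end Summit.QuantumFields.YangMills.BalabanUVNodes.N15.SiteLayerSf

end
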